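import Summits.QuantumFields.BalabanUV.T4Continuum.Support.NE7LawLevelOldLayers

/-!
# NE7, ROAD P4 (law-level): the LABELLED reverse filtration and the CONTRACTION of one variable's increments

(Cell `pub-balaban`, sub-cell `t4`, binder row NE7 = node U5, co-owner #4 `b2b-balaban-t4-ne7-p4`, gen 5; skeleton
`HOME/t4/skeletons/NE7-t4-ne7-p4.md` §2 NODE Q.old (v1.11) and `HOME/t4/b2b-balaban-t4-ne7-p4/g5/BOOKING-H-NE7-P4.md`.
Imports the road's `NE7LawLevelOldLayers` (p209362: the exact layer identity
`integral_sq_eq_noise_add_layers_add_mean` along an antitone filtration) and, through it, row NE1′'s [folklore]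
`T4MeanChannel` (Doob–Lévy increments `incr μ F f i`, (K14u) `integral_sq_condExp_sub_eq_sum`), BY NAME.  Companion
file: `NE7LawLevelAbsorption` (the absorption lemma), which imports this one.)

HONEST FRAMING (T4-DAG PAGE 1).  Rung (B)+1 on ONE FIXED finite four-torus, CONDITIONAL on `BetaPertH` and the nine
spine estimates (0/9 proved); NOT infinite volume, NOT a mass gap, NOT the Clay problem.  NE7 is NOT PRINTED and NOT
proved here; every theorem below is [folklore] measure theory over plain probabilistic data, sorry-free; no statement
of the audited series ([Balaban1988Convergent], [Balaban1989LargeFieldI], [Balaban1989LargeFieldII]) is asserted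
or used; NOT summit progress.

WHAT THIS FILE DOES (the assigned technique «second moment along the chain's own reverse filtration»).
§0 THE LABELLED FILTRATION.  NODE Q.old takes the second moment of the age-`n` first-order summand `S` along an
antitone family `F j` (the chain's future from time `K − n + j`).  Joining a FIXED sub-σ-algebra `H` — DICTIONARY: the
σ-algebra of the cumulative LARGE-FIELD HISTORY (term label) of the run, which the Markov state of the (ℝT)-chain
carries anyway (skeleton Q.0, v1.7: «ℝ is a resampling Markov kernel on the state (term label, field)») — keeps the
family antitone (`antitone_sup_label`), so the exact layer identity holds VERBATIM along `j ↦ F j ⊔ H`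
(`integral_sq_eq_layers_add_mean_labelled`); conditionally on the label every layer is ONE FIXED-TERM backward step:
no mixture over the terms of a level is ever formed, so the between-term variance of PROOF-QV §6 (6b) — the object of
the synth's Q17 ∕ G-stochqg9-1 ∕ G-ne7idedimock13-1 — does not occur in this booking (BOOKING-H §1; what the label
costs instead — coherent squares over its components, per-term structure — is booked there, not here).
§1 CONTRACTION.  For ONE a.e.-bounded variable `f`, the increments along any antitone filtration have total second
moment at most `∫ f²` (`sum_integral_incr_sq_le`; orthogonality (K14u) + two Pythagoras steps; a.e. bounds suffice by
truncation).  DICTIONARY: a defect born at some layer costs, over ALL later layers together, at most its second moment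
at birth — the engine of the absorption lemma.  Nothing here is an estimate about Bałaban's chain.
-/

noncomputable section

open MeasureTheory Finset Filter
open scoped BigOperators

namespace Summit.QuantumFields.BalabanUV.T4Continuum.NE7LawLevel

open Literature.MathematicalPhysics.QuantumFieldTheory.Balaban1983to89
open Literature.MathematicalPhysics.QuantumFieldTheory.Balaban1983to89.T4MeanChannel

variable {Ω : Type*} {mΩ : MeasurableSpace Ω} {μ : Measure Ω} {F : ℕ → MeasurableSpace Ω}

/-! ## §0 The labelled reverse filtration -/

section Labelled

/-- Joining a FIXED sub-σ-algebra (the large-field history ∕ term label) to an antitone filtration keeps it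
antitone. [folklore] -/
theorem antitone_sup_label (hF : Antitone F) (H : MeasurableSpace Ω) : Antitone fun j => F j ⊔ H :=
  fun _ _ h => sup_le_sup_right (hF h) H

/-- … and below the ambient σ-algebra. [folklore] -/
theorem sup_label_le (hFle : ∀ j, F j ≤ mΩ) {H : MeasurableSpace Ω} (hH : H ≤ mΩ) (j : ℕ) :
    F j ⊔ H ≤ mΩ :=
  sup_le (hFle j) hH

/-- **THE LAYER IDENTITY ALONG THE LABELLED FILTRATION.**  If `S` is measurable for `F 0 ⊔ H` (DICTIONARY: the age-`n`
kick summand is a function of the level-`k` state, label included) then, for every depth `J`,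
`∫ S² = Σ_{j<J} ∫ (incr μ (F · ⊔ H) S j)² + ∫ (μ[S | F J ⊔ H])²` — the noise term of
`integral_sq_eq_noise_add_layers_add_mean` vanishes and every layer is conditional on the label. [folklore] -/
theorem integral_sq_eq_layers_add_mean_labelled [IsFiniteMeasure μ] (hF : Antitone F) (hFle : ∀ j, F j ≤ mΩ)
    {H : MeasurableSpace Ω} (hH : H ≤ mΩ) {S : Ω → ℝ} (hS0 : StronglyMeasurable[F 0 ⊔ H] S) {B : ℝ}
    (hSb : ∀ ω, |S ω| ≤ B) (J : ℕ) :
    ∫ ω, S ω ^ 2 ∂μ = ∑ j ∈ range J, ∫ ω, incr μ (fun i => F i ⊔ H) S j ω ^ 2 ∂μ +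
      ∫ ω, (μ[S|F J ⊔ H]) ω ^ 2 ∂μ := by
  have hGle : ∀ j, F j ⊔ H ≤ mΩ := sup_label_le hFle hH
  haveI : SigmaFinite (μ.trim (hGle 0)) := inferInstance
  have hSm : AEStronglyMeasurable[mΩ] S μ := (hS0.mono (hGle 0)).aestronglyMeasurable
  have hSi : Integrable S μ := integrable_of_ae_abs_le hSm (ae_of_all μ hSb)
  have h := integral_sq_eq_noise_add_layers_add_mean (μ := μ) (antitone_sup_label hF H) hGle hSm hSb J
  have h0 : μ[S|F 0 ⊔ H] = S := condExp_of_stronglyMeasurable (hGle 0) hS0 hSi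
  have hnoise : ∫ ω, (S ω - μ[S|F 0 ⊔ H] ω) ^ 2 ∂μ = 0 := by
    simp only [h0, sub_self, zero_pow two_ne_zero, integral_zero]
  rw [h]
  change ∫ ω, (S ω - μ[S|F 0 ⊔ H] ω) ^ 2 ∂μ + _ + _ = _
  rw [hnoise, zero_add]

end Labelled

/-! ## §1 Contraction: the increments of ONE a.e.-bounded variable -/

section Contraction

/-- a.e.-bounded version of (K14q): increments of an a.e.-bounded observable are a.e. bounded by twice the bound.
[folklore] -/
theorem ae_abs_incr_le_of_ae {f : Ω → ℝ} {R : ℝ} (hf : ∀ᵐ ω ∂μ, |f ω| ≤ R) (i : ℕ) :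
    ∀ᵐ ω ∂μ, |incr μ F f i ω| ≤ 2 * R := by
  filter_upwards [ae_bdd_abs_condExp_of_ae_bdd_abs (μ := μ) (m := F i) hf,
    ae_bdd_abs_condExp_of_ae_bdd_abs (μ := μ) (m := F (i + 1)) hf] with ω h1 h2
  rw [incr_apply]
  obtain ⟨h1l, h1u⟩ := abs_le.mp h1
  obtain ⟨h2l, h2u⟩ := abs_le.mp h2
  exact abs_le.mpr ⟨by linarith, by linarith⟩

/-- **CONTRACTION.**  Along an antitone filtration the increments of ONE a.e.-bounded, a.e.-strongly measurable
variable `f` have total second moment at most `∫ f²`:  `Σ_{j<d} ∫ (incr μ F f j)² ≤ ∫ f²`.  (Orthogonality (K14u):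
the sum equals `∫ (μ[f|F 0] − μ[f|F d])²`; two Pythagoras steps; an everywhere-bounded modification of `f` carries the
computation.)  DICTIONARY: a defect born at some layer costs, over ALL later layers together, at most its birth second
moment. [folklore] -/
theorem sum_integral_incr_sq_le [IsFiniteMeasure μ] (hF : Antitone F) (hFle : ∀ j, F j ≤ mΩ) {f : Ω → ℝ}
    (hfm : AEStronglyMeasurable f μ) {R : ℝ} (hfb : ∀ᵐ ω ∂μ, |f ω| ≤ R) (d : ℕ) :
    ∑ j ∈ range d, ∫ ω, incr μ F f j ω ^ 2 ∂μ ≤ ∫ ω, f ω ^ 2 ∂μ := by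
  -- an everywhere-bounded modification of `f`
  set R' : ℝ := max R 0 with hR'
  have hR'0 : 0 ≤ R' := le_max_right _ _
  set f' : Ω → ℝ := fun ω => max (-R') (min R' (f ω)) with hf'
  have hf'b : ∀ ω, |f' ω| ≤ R' := fun ω => by
    rw [abs_le]
    refine ⟨le_max_left _ _, max_le (by linarith) (min_le_left _ _)⟩
  have hff' : f =ᵐ[μ] f' := hfb.mono fun ω hω => by
    have h1 : |f ω| ≤ R' := hω.trans (le_max_left _ _)
    obtain ⟨hl, hu⟩ := abs_le.mp h1
    show f ω = max (-R') (min R' (f ω))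
    rw [min_eq_right hu, max_eq_right hl]
  have hf'm : AEStronglyMeasurable f' μ :=
    (aemeasurable_const.max (aemeasurable_const.min hfm.aemeasurable)).aestronglyMeasurable
  have hincr : ∀ j, ∫ ω, incr μ F f j ω ^ 2 ∂μ = ∫ ω, incr μ F f' j ω ^ 2 ∂μ := fun j => by
    refine integral_congr_ae ?_
    filter_upwards [condExp_congr_ae (μ := μ) (m := F j) hff',
      condExp_congr_ae (μ := μ) (m := F (j + 1)) hff'] with ω h1 h2
    simp only [incr_apply, h1, h2]
  rw [sum_congr rfl fun j _ => hincr j]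
  have h1 := integral_sq_condExp_sub_eq_sum (μ := μ) hF hFle hf'b 0 d
  have h2 := integral_sq_condExp_eq_sq_sub_add_sq (μ := μ) hF hFle hf'b 0 d
  have h3 := integral_sq_eq_integral_sq_sub_condExp_add (μ := μ) hFle hf'm hf'b 0
  have h4 : ∫ ω, f ω ^ 2 ∂μ = ∫ ω, f' ω ^ 2 ∂μ :=
    integral_congr_ae (hff'.mono fun ω h => by simp only [h])
  simp only [zero_add] at h1 h2
  calc ∑ j ∈ range d, ∫ ω, incr μ F f' j ω ^ 2 ∂μ
        = ∫ ω, (μ[f'|F 0] ω - μ[f'|F d] ω) ^ 2 ∂μ := h1.symm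
    _ ≤ ∫ ω, (μ[f'|F 0]) ω ^ 2 ∂μ := by
        rw [h2]; exact le_add_of_nonneg_right (integral_nonneg fun _ => sq_nonneg _)
    _ ≤ ∫ ω, f' ω ^ 2 ∂μ := by
        rw [h3]; exact le_add_of_nonneg_left (integral_nonneg fun _ => sq_nonneg _)
    _ = ∫ ω, f ω ^ 2 ∂μ := h4.symm

end Contraction

end Summit.QuantumFields.BalabanUV.T4Continuum.NE7LawLevel

end
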